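import Literature.AnabelianGeometry.EtaleTheta.SettingModelChiGroupLevel
import Literature.AnabelianGeometry.EtaleTheta.SettingModelGfpSlim
import HarnessLib

/-!
# The χ-twisted root model of [EtTh] §1 (R78 (B)): `GroupLevelData (curveχ p)` UNCONDITIONALLY — the capstone

Mochizuki, *Semi-graphs of anabelioids*, Publ. RIMS **42** (2006) [SemiAnbd], Example 3.10 pp. 43–45 («`π₁^temp(X_K)`
is a tempered topological group», «`Δ` is also tempered», «both `Δ` and `Π` are temp-slim»)
[cite: MochizukiSemiAnbd2006, Ex 3.10 p.45]; [IUTchI] Rmk. 2.5.3 (i) (T1) «Galois-countable»; [EtTh] §1 p. 12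
[cite: MochizukiEtTh2009, §1 p.12].  abc-iut cell, seat abc-iut-w5-d111 (gen 4); PROOF-ONLY sequel (0 definitions) of
abc-iut-w5-d249's CONDITIONAL assembly `nonempty_groupLevelData_curveχ (hΓ) (hsc)` (SettingModelChiGroupLevel,
p431012) with both binders DISCHARGED by this seat's `isSlimGroup_gfp` / `secondCountableTopology_PiTpχ`
(SettingModelGfpSlim, p431378):

* `isSlimGroup_PiTpχ_holds` — `Π^tp_X = Γ ⋊_χ G_{ℚ_p}` IS SLIM (no hypothesis); `isSlimGroup_deltaTempχ_holds` —
  `Δ^tp_X` IS SLIM; read on the record: `isSlimGroup_piTemp_curveχ`;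
* **`nonempty_groupLevelData_curveχ_holds : Nonempty (TemperedCurve.GroupLevelData (curveχ p))`** — abc-iut-L3's
  group-level parameter bundle (ruling η′: `galEquiv`, `Π`/`Δ` tempered, `Π`/`Δ` temp-slim, `Π` Galois-countable) is
  INHABITED at the χ-twisted model with NO binder; hence `exists_toTemperedArithmeticGroup_curveχ_holds` — the bridge
  of ruling η yields a `TemperedArithmeticGroup ℚ_p`-datum of [SemiAnbd] Ex. 3.10 with `Π := Γ ⋊_χ G_{ℚ_p}`.

HONEST LABEL: semi-synthetic model (not the tempered `π₁` of a curve) — consistency evidence for the axiom package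
only; classical profinite/tempered group theory; nothing of [EtTh]/[SemiAnbd] asserted; no side taken on [IUTchIII]
Cor. 3.12.
-/

noncomputable section

namespace Literature.AnabelianGeometry.EtaleTheta.SettingModel

open Literature.AnabelianGeometry.SemiGraphs Literature.AlgebraicGeometry.Frobenioids

variable (p : ℕ) [Fact p.Prime]

/-- **`Π^tp_X = Γ ⋊_χ G_{ℚ_p}` of the χ-twisted model is slim** — unconditionally: abc-iut-w5-d249's
`isSlimGroup_PiTpχ` at this seat's `isSlimGroup_gfp` (Γ = F̂₂ ×_Ẑ ℤ slim). [cite: MochizukiSemiAnbd2006, Ex 3.10 p.45] -/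
theorem isSlimGroup_PiTpχ_holds : IsSlimGroup (PiTpχ p) :=
  isSlimGroup_PiTpχ p isSlimGroup_gfp

/-- The same, read on the record `curveχ p`: the `isSlimGroup` field of `TemperedCurve.GroupLevelData (curveχ p)`.
[cite: MochizukiSemiAnbd2006, Ex 3.10 p.45] -/
theorem isSlimGroup_piTemp_curveχ : IsSlimGroup (curveχ p).PiTemp :=
  isSlimGroup_PiTpχ_holds p

/-- **`Δ^tp_X` of the χ-twisted model is slim** — unconditionally («both `Δ` and `Π` are temp-slim», Ex. 3.10 p. 45,
at the model). [cite: MochizukiSemiAnbd2006, Ex 3.10 p.45] -/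
theorem isSlimGroup_deltaTempχ_holds : IsSlimGroup (curveχ p).DeltaTemp :=
  isSlimGroup_deltaTempχ p isSlimGroup_gfp

/-- **The group-level datum of the χ-twisted model, UNCONDITIONALLY**: abc-iut-L3's parameter bundle
`TemperedCurve.GroupLevelData (curveχ p)` («`Π`, `Δ` tempered», «`Π`, `Δ` temp-slim», «`Π` Galois-countable»,
`G_K ≃ Gal(K̄/K)`) is inhabited — abc-iut-w5-d249's conditional assembly with `hΓ := isSlimGroup_gfp`,
`hsc := secondCountableTopology_PiTpχ p`. [cite: MochizukiSemiAnbd2006, Ex 3.10 p.45] -/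
theorem nonempty_groupLevelData_curveχ_holds : Nonempty (TemperedCurve.GroupLevelData (curveχ p)) :=
  nonempty_groupLevelData_curveχ p isSlimGroup_gfp (secondCountableTopology_PiTpχ p)

/-- Consequently the bridge of abc-iut-L3-lead's ruling η fires at the χ-twisted model with NO binder: a
`TemperedArithmeticGroup ℚ_p`-datum of [SemiAnbd] Ex. 3.10 with `Π := Γ ⋊_χ G_{ℚ_p}`.
[cite: MochizukiSemiAnbd2006, Ex 3.10 p.43] -/
theorem exists_toTemperedArithmeticGroup_curveχ_holds :
    ∃ d : TemperedCurve.GroupLevelData (curveχ p), ((curveχ p).toTemperedArithmeticGroup d).Pi = PiTpχ p :=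
  exists_toTemperedArithmeticGroup_curveχ p isSlimGroup_gfp (secondCountableTopology_PiTpχ p)

/-- In particular abc-iut-L3's group-level interface `TemperedArithmeticGroup K` of [SemiAnbd] Ex. 3.10 has an
inhabitant over the base field of the χ-model (`(curveχ p).K = ℚ_p` inside `ℚ̄_p`) whose group is the NON-split,
Galois-twisted `Γ ⋊_χ G_{ℚ_p}` (its `Δ` is `(curveχ p).DeltaTemp ≃ Γ = F̂₂ ×_Ẑ ℤ`, `toTemperedArithmeticGroup_delta`).
[cite: MochizukiSemiAnbd2006, Ex 3.10 p.43] -/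
theorem exists_temperedArithmeticGroup_pi_eq_PiTpχ :
    ∃ T : TemperedArithmeticGroup (curveχ p).K, T.Pi = PiTpχ p := by
  obtain ⟨d, hd⟩ := exists_toTemperedArithmeticGroup_curveχ_holds p
  exact ⟨(curveχ p).toTemperedArithmeticGroup d, hd⟩

end Literature.AnabelianGeometry.EtaleTheta.SettingModel

end
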